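import Summits.BirchSwinnertonDyer.BirchSwinnertonDyer.Theorems.QuadraticBranchSignedControlPlusEtaLowerInclusionFunctionalEquationSqueezeUnitCoeff
import HarnessLib

/-!
# Route `QuadraticBranchSignedControl` (rung K8, cell `bsd-potss`), crux `PlusEtaLowerInclusion`
# (item stmt-BirchSwinnertonDyer-19601): the PRIME-COFACTOR SQUEEZE, part 1 — Λ-ALGEBRA: the top-segment
# (Dumas / Newton-polygon) primality criterion in `ℤ_p⟦T⟧` and the squeeze without a functional equation
# (seat `bsd-potss-k8eta-c1` g12; `--supports` 19601)

WHAT. Gen 11's functional-equation squeeze closes a tower-onto pair from ONE factor of `p` when the cofactor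
`L_p⁺(V,η,T)/T^r` has Weierstrass degree `2`. On the census row `288600bn1` (the LAST rank-zero residue row:
`ord₅ Tam = 1`, `ord₅ #Ш_an = 2`, `λ⁺_η = 4`) the cofactor has degree `4`, and kit j305787/j306125 (engine B, exact
η-twisted Mazur–Tate elements, levels `5⁸…5¹⁰`) read its Newton polygon as ONE segment `(0,3)–(4,0)`. THIS FILE is
the Λ-algebra that turns such a reading into primality, FE-free:
* `PrimeCofactor.irreducible_of_topSegment` — a monic `P ∈ ℤ_p[X]` of degree `d ≥ 1` with `p^{d−i} ∣ P_i`
  (`0 < i < d`) and `p^{d−1} ∥ P_0` is IRREDUCIBLE: `X^d·P(p/X)/p^{d−1}` is Eisenstein at `(p)` (Mathlib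
  `Polynomial.IsEisensteinAt.irreducible`), and a monic factorisation of `P` transports to it through
  `reverse`/`scaleRoots` and Gauss's lemma over `ℚ_p` — the Dumas criterion for the segment of slope `(d−1)/d`;
* `PrimeCofactor.prime_coe_of_topSegment` (`d ≥ 2`) — such `P` is distinguished, hence PRIME in `Λ = ℤ_p⟦T⟧`
  (UFD `ℤ_p[X]` + Weierstrass division, tree `span_coe_isPrime_of_dvd`);
* `PrimeCofactor.prime_of_topSegment_coeff` — the same read on a POWER SERIES `M` from its coefficients
  `0..d` (`p ∤ coeff_d`, `p^{d−i} ∣ coeff_i`, `p^{d−1} ∥ coeff_0`): Weierstrass preparation `M = P·h` and the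
  bounds pass to `P` because they decrease with the index;
* `PrimeCofactor.span_singleton_eq_of_prime_cofactor` — THE SQUEEZE: `T^r ∣ g ∣ L = T^r·M`, `M` prime,
  `p ∣ coeff_r g` ⟹ `(g) = (L)` — no involution, no B. D. Kim functional equation.
Part 2 (`…PrimeCofactor.lean`) is the road and the record for `288600bn1`.

HONEST FRAMING (cell `bsd-potss`, run/shared/lean/pub/bsd-potss/; FULL-BSD rank ≤ 1 programme, HUMAN RULING
D-0036/D-0074): PURE ALGEBRA, no named fact, no elliptic curve; tools for per-row instances of an OPEN class-wide
crux; nothing is booked. No definition, no `sorry`, axioms standard.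

References: [Washington1997] §7.1 Thm. 7.3 (Weierstrass preparation), Prop. 7.2, §13.2; [KimBD2008MRL] §1 p. 83
(shape of the cofactor; not used); Dumas's criterion (1906) in its Eisenstein form.
-/

set_option autoImplicit false
set_option linter.dupNamespace false

noncomputable section

open scoped Classical

open Polynomial
open Literature.NumberTheory.EllipticCurves
open Literature.NumberTheory.EllipticCurves.IwasawaDual
open Literature.NumberTheory.EllipticCurves.IwasawaAlgebra

namespace Summit.BirchSwinnertonDyer.BirchSwinnertonDyer.Theorems

/-! ## §1 `Λ`-algebra: the top segment of the Newton polygon -/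

namespace PrimeCofactor

variable (p : ℕ) [hp : Fact p.Prime]

/-- **Newton-polygon (Dumas) irreducibility, top segment `(0, d−1)–(d, 0)`.** A monic `P ∈ ℤ_p[X]` of degree
`d ≥ 1` with `p^{d−i} ∣ P_i` for `0 < i < d`, `p^{d−1} ∣ P_0` and `p^d ∤ P_0` is irreducible: the polynomial
`X^d·P(p/X)/p^{d−1}` is Eisenstein at `(p)`, and a monic factorisation of `P` would transport to it
(`reverse`, `scaleRoots`, Gauss's lemma). [cite: Washington1997, §7.1] -/
theorem irreducible_of_topSegment (P : Polynomial ℤ_[p]) (hmon : P.Monic) {d : ℕ} (hdeg : P.natDegree = d)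
    (hd1 : 1 ≤ d) (hcoef : ∀ i, 0 < i → i < d → (p : ℤ_[p]) ^ (d - i) ∣ P.coeff i)
    (h0 : (p : ℤ_[p]) ^ (d - 1) ∣ P.coeff 0) (h0' : ¬ (p : ℤ_[p]) ^ d ∣ P.coeff 0) :
    Irreducible P := by
  have hpprime : Prime (p : ℤ_[p]) := PadicInt.prime_p
  have hp0 : (p : ℤ_[p]) ≠ 0 := hpprime.ne_zero
  have hP00 : P.coeff 0 ≠ 0 := fun h => h0' (by rw [h]; exact dvd_zero _)
  -- the transform `T f = (reverse f).scaleRoots p`, i.e. `X^{deg f} f(p/X)`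
  set c : ℤ_[p] := (p : ℤ_[p]) ^ (d - 1) with hc
  have hc0 : c ≠ 0 := pow_ne_zero _ hp0
  have hrevdeg : P.reverse.natDegree = d := by
    rw [reverse_natDegree, hdeg, natTrailingDegree_eq_zero.mpr (Or.inr hP00), Nat.sub_zero]
  have hTdeg : (P.reverse.scaleRoots (p : ℤ_[p])).natDegree = d := by rw [natDegree_scaleRoots, hrevdeg]
  -- coefficients of `T P`: `coeff j = P_{d-j} p^{d-j}` for `j ≤ d`
  have hTcoeff : ∀ j ≤ d, (P.reverse.scaleRoots (p : ℤ_[p])).coeff j = P.coeff (d - j) * (p : ℤ_[p]) ^ (d - j) := by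
    intro j hj
    rw [coeff_scaleRoots, hrevdeg, coeff_reverse, hdeg, revAt_le hj]
  -- `c ∣` every coefficient of `T P`
  have hcdvd : ∀ j, c ∣ (P.reverse.scaleRoots (p : ℤ_[p])).coeff j := by
    intro j
    by_cases hj : j ≤ d
    · rw [hTcoeff j hj]
      rcases Nat.eq_or_lt_of_le hj with rfl | hjd
      · rw [Nat.sub_self, pow_zero, mul_one]; exact h0
      · by_cases hj0 : j = 0
        · subst hj0
          rw [Nat.sub_zero, ← hdeg, ← Polynomial.leadingCoeff, hmon.leadingCoeff, one_mul, hdeg, hc]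
          exact pow_dvd_pow _ (Nat.sub_le d 1)
        · -- `0 < d - j < d`: `p^{j} ∣ P_{d-j}`, so `p^{d} ∣ P_{d-j} p^{d-j}`
          have hi1 : 0 < d - j := Nat.sub_pos_of_lt hjd
          have hi2 : d - j < d := Nat.sub_lt (by omega) (Nat.pos_of_ne_zero hj0)
          have h1 := hcoef (d - j) hi1 hi2
          rw [show d - (d - j) = j from by omega] at h1
          calc c ∣ (p : ℤ_[p]) ^ d := pow_dvd_pow _ (Nat.sub_le d 1)
            _ = (p : ℤ_[p]) ^ j * (p : ℤ_[p]) ^ (d - j) := by rw [← pow_add]; congr 1; omega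
            _ ∣ P.coeff (d - j) * (p : ℤ_[p]) ^ (d - j) := mul_dvd_mul_right h1 _
    · rw [coeff_eq_zero_of_natDegree_lt (by rw [hTdeg]; omega)]
      exact dvd_zero _
  obtain ⟨Q, hQ⟩ := (C_dvd_iff_dvd_coeff c _).mpr hcdvd
  -- coefficients of `Q`
  have hQcoeff : ∀ j ≤ d, c * Q.coeff j = P.coeff (d - j) * (p : ℤ_[p]) ^ (d - j) := by
    intro j hj
    rw [← hTcoeff j hj, hQ, coeff_C_mul]
  have hpow : (p : ℤ_[p]) ^ d = c * (p : ℤ_[p]) := by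
    rw [hc, ← pow_succ]; congr 1; omega
  have hQdeg : Q.natDegree = d := by
    have := congrArg natDegree hQ
    rwa [hTdeg, natDegree_C_mul hc0, eq_comm] at this
  -- `Q` is Eisenstein at `(p)`
  have hQd : ¬ (p : ℤ_[p]) ∣ Q.coeff d := by
    intro hdvd
    apply h0'
    have h := hQcoeff d le_rfl
    rw [Nat.sub_self, pow_zero, mul_one] at h
    rw [← h, hpow]
    exact mul_dvd_mul_left _ hdvd
  have hQ0 : Q.coeff 0 = p := by
    have h := hQcoeff 0 (Nat.zero_le d)
    rw [Nat.sub_zero, ← hdeg, ← Polynomial.leadingCoeff, hmon.leadingCoeff, one_mul, hdeg, hpow] at h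
    exact mul_left_cancel₀ hc0 h
  have hQmem : ∀ j < d, (p : ℤ_[p]) ∣ Q.coeff j := by
    intro j hjd
    by_cases hj0 : j = 0
    · subst hj0; rw [hQ0]
    · have h := hQcoeff j hjd.le
      have hi1 : 0 < d - j := Nat.sub_pos_of_lt hjd
      have hi2 : d - j < d := Nat.sub_lt (by omega) (Nat.pos_of_ne_zero hj0)
      have h1 := hcoef (d - j) hi1 hi2
      rw [show d - (d - j) = j from by omega] at h1
      have h2 : c * (p : ℤ_[p]) ∣ c * Q.coeff j := by
        have hpow2 : (p : ℤ_[p]) ^ d = (p : ℤ_[p]) ^ j * (p : ℤ_[p]) ^ (d - j) := by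
          rw [← pow_add]; congr 1; omega
        rw [h, ← hpow, hpow2]
        exact mul_dvd_mul_right h1 _
      exact (mul_dvd_mul_iff_left hc0).mp h2
  have hspan : Ideal.span {(p : ℤ_[p])} = IsLocalRing.maximalIdeal ℤ_[p] :=
    PadicInt.maximalIdeal_eq_span_p.symm
  have hEis : Q.IsEisensteinAt (Ideal.span {(p : ℤ_[p])}) := by
    refine ⟨?_, ?_, ?_⟩
    · rw [Polynomial.leadingCoeff, hQdeg, Ideal.mem_span_singleton]; exact hQd
    · intro n hn; rw [hQdeg] at hn; rw [Ideal.mem_span_singleton]; exact hQmem n hn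
    · rw [hQ0, Ideal.span_singleton_pow, Ideal.mem_span_singleton, pow_two]
      intro h
      exact hpprime.not_unit (isUnit_of_dvd_one (by
        obtain ⟨t, ht⟩ := h
        exact ⟨t, mul_left_cancel₀ hp0 (by rw [← mul_assoc, ← ht, mul_one])⟩))
  have hQlead : IsUnit Q.leadingCoeff := by
    rw [Polynomial.leadingCoeff, hQdeg]
    by_contra hnu
    apply hQd
    have : Q.coeff d ∈ IsLocalRing.maximalIdeal ℤ_[p] := (IsLocalRing.mem_maximalIdeal _).mpr hnu
    rwa [← hspan, Ideal.mem_span_singleton] at this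
  have hQprim : Q.IsPrimitive := fun r hr => by
    rw [C_dvd_iff_dvd_coeff] at hr
    have h := hr Q.natDegree
    exact isUnit_of_dvd_unit h hQlead
  haveI : (Ideal.span {(p : ℤ_[p])}).IsPrime := by rw [hspan]; infer_instance
  have hQirr : Irreducible Q := hEis.irreducible inferInstance hQprim (by rw [hQdeg]; exact hd1)
  have hQirrK : Irreducible (Q.map (algebraMap ℤ_[p] ℚ_[p])) :=
    (hQprim.irreducible_iff_irreducible_map_fraction_map (K := ℚ_[p])).mp hQirr
  -- a monic factorisation of `P` transports to a factorisation of `c • Q` over `ℚ_p`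
  rw [hmon.irreducible_iff_natDegree]
  refine ⟨fun h1 => by have := congrArg natDegree h1; rw [hdeg, natDegree_one] at this; omega, ?_⟩
  intro f g hf hg hfg
  by_contra hne
  obtain ⟨hf0, hg0⟩ := not_or.mp hne
  have hf00 : f.coeff 0 ≠ 0 := by
    intro h; apply hP00
    rw [← hfg, mul_coeff_zero, h, zero_mul]
  have hg00 : g.coeff 0 ≠ 0 := by
    intro h; apply hP00
    rw [← hfg, mul_coeff_zero, h, mul_zero]
  have hTf : (f.reverse.scaleRoots (p : ℤ_[p])).natDegree = f.natDegree := by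
    rw [natDegree_scaleRoots, reverse_natDegree, natTrailingDegree_eq_zero.mpr (Or.inr hf00), Nat.sub_zero]
  have hTg : (g.reverse.scaleRoots (p : ℤ_[p])).natDegree = g.natDegree := by
    rw [natDegree_scaleRoots, reverse_natDegree, natTrailingDegree_eq_zero.mpr (Or.inr hg00), Nat.sub_zero]
  have hprod : C c * Q = f.reverse.scaleRoots (p : ℤ_[p]) * g.reverse.scaleRoots (p : ℤ_[p]) := by
    rw [← hQ, ← hfg, reverse_mul_of_domain, mul_scaleRoots_of_noZeroDivisors]
  -- map to `ℚ_p[X]`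
  have hinj : Function.Injective (algebraMap ℤ_[p] ℚ_[p]) := IsFractionRing.injective ℤ_[p] ℚ_[p]
  have hmap := congrArg (Polynomial.map (algebraMap ℤ_[p] ℚ_[p])) hprod
  rw [Polynomial.map_mul, Polynomial.map_mul, Polynomial.map_C] at hmap
  have hcK : IsUnit (C (algebraMap ℤ_[p] ℚ_[p] c)) :=
    isUnit_C.mpr (IsUnit.mk0 _ ((map_ne_zero_iff _ hinj).mpr hc0))
  have hirr : Irreducible (C (algebraMap ℤ_[p] ℚ_[p] c) * Q.map (algebraMap ℤ_[p] ℚ_[p])) :=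
    (irreducible_isUnit_mul hcK).mpr hQirrK
  rw [hmap] at hirr
  rcases hirr.isUnit_or_isUnit rfl with hu | hu
  · have h := natDegree_eq_zero_of_isUnit hu
    rw [natDegree_map_eq_of_injective hinj, hTf] at h
    exact hf0 h
  · have h := natDegree_eq_zero_of_isUnit hu
    rw [natDegree_map_eq_of_injective hinj, hTg] at h
    exact hg0 h

/-- Such a `P` (with `d ≥ 2`) is DISTINGUISHED at `(p)`: monic with all lower coefficients in `(p)`. [folklore] -/
theorem isDistinguishedAt_of_topSegment (P : Polynomial ℤ_[p]) (hmon : P.Monic) {d : ℕ}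
    (hdeg : P.natDegree = d) (hd2 : 2 ≤ d) (hcoef : ∀ i, 0 < i → i < d → (p : ℤ_[p]) ^ (d - i) ∣ P.coeff i)
    (h0 : (p : ℤ_[p]) ^ (d - 1) ∣ P.coeff 0) :
    P.IsDistinguishedAt (IsLocalRing.maximalIdeal ℤ_[p]) := by
  refine ⟨⟨fun {n} hn => ?_⟩, hmon⟩
  rw [PadicInt.maximalIdeal_eq_span_p, Ideal.mem_span_singleton]
  rw [hdeg] at hn
  by_cases hn0 : n = 0
  · subst hn0
    exact (dvd_pow_self _ (by omega)).trans h0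
  · exact (dvd_pow_self _ (by omega)).trans (hcoef n (Nat.pos_of_ne_zero hn0) hn)

/-- **Such a `P` (with `d ≥ 2`) is PRIME in `Λ = ℤ_p⟦T⟧`**: irreducible in the UFD `ℤ_p[T]`, hence prime there,
and a distinguished polynomial generating a prime ideal of `ℤ_p[T]` generates a prime ideal of `Λ`
(Weierstrass division, tree `span_coe_isPrime_of_dvd`). [cite: Washington1997, Prop. 7.2 and §13.2] -/
theorem prime_coe_of_topSegment (P : Polynomial ℤ_[p]) (hmon : P.Monic) {d : ℕ} (hdeg : P.natDegree = d)
    (hd2 : 2 ≤ d) (hcoef : ∀ i, 0 < i → i < d → (p : ℤ_[p]) ^ (d - i) ∣ P.coeff i)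
    (h0 : (p : ℤ_[p]) ^ (d - 1) ∣ P.coeff 0) (h0' : ¬ (p : ℤ_[p]) ^ d ∣ P.coeff 0) :
    Prime (P : IwasawaAlgebra p) := by
  have hirr := irreducible_of_topSegment p P hmon hdeg (by omega) hcoef h0 h0'
  have hPprime : Prime P := UniqueFactorizationMonoid.irreducible_iff_prime.mp hirr
  haveI : (Ideal.span {P}).IsPrime := (Ideal.span_singleton_prime hmon.ne_zero).mpr hPprime
  have hPne : (P : IwasawaAlgebra p) ≠ 0 := fun h => hmon.ne_zero (by exact_mod_cast h)
  exact (Ideal.span_singleton_prime hPne).mp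
    (span_coe_isPrime_of_dvd (isDistinguishedAt_of_topSegment p P hmon hdeg hd2 hcoef h0) (q := P) (dvd_refl P))

/-- **THE TOP-SEGMENT CRITERION ON A POWER SERIES.** `M ∈ Λ = ℤ_p⟦T⟧` with `coeff_d M ∈ ℤ_pˣ` (`d ≥ 2`),
`p^{d−i} ∣ coeff_i M` (`0 < i < d`), `p^{d−1} ∣ coeff_0 M`, `p^d ∤ coeff_0 M` — the Newton polygon of `M` is the
single segment `(0, d−1)–(d, 0)` — is PRIME in `Λ`: by Weierstrass preparation `M = P·h` with `h ∈ Λˣ` and `P`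
distinguished of degree `d` inheriting the three coefficient conditions (the bounds decrease with the index),
and `P` is prime by `prime_coe_of_topSegment`. [cite: Washington1997, §7.1 Thm. 7.3] -/
theorem prime_of_topSegment_coeff {M : IwasawaAlgebra p} {d : ℕ} (hd2 : 2 ≤ d)
    (hunit : ¬ (p : ℤ_[p]) ∣ PowerSeries.coeff d M)
    (hcoef : ∀ i, 0 < i → i < d → (p : ℤ_[p]) ^ (d - i) ∣ PowerSeries.coeff i M)
    (h0 : (p : ℤ_[p]) ^ (d - 1) ∣ PowerSeries.coeff 0 M) (h0' : ¬ (p : ℤ_[p]) ^ d ∣ PowerSeries.coeff 0 M) :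
    Prime M := by
  have hpprime : Prime (p : ℤ_[p]) := PadicInt.prime_p
  -- the reduction of `M` mod `p` has order exactly `d`
  have hres : ∀ i, PowerSeries.coeff i (M.map (IsLocalRing.residue ℤ_[p])) = 0 ↔ (p : ℤ_[p]) ∣ PowerSeries.coeff i M := by
    intro i
    rw [PowerSeries.coeff_map, IsLocalRing.residue_eq_zero_iff, PadicInt.maximalIdeal_eq_span_p,
      Ideal.mem_span_singleton]
  have hresd : PowerSeries.coeff d (M.map (IsLocalRing.residue ℤ_[p])) ≠ 0 := fun h => hunit ((hres d).mp h)
  have hMres : M.map (IsLocalRing.residue ℤ_[p]) ≠ 0 := fun h0 => hresd (by rw [h0, map_zero])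
  have horder : (M.map (IsLocalRing.residue ℤ_[p])).order = d := by
    refine (PowerSeries.order_eq_nat).mpr ⟨hresd, fun i hi => (hres i).mpr ?_⟩
    by_cases hi0 : i = 0
    · subst hi0; exact (dvd_pow_self _ (by omega)).trans h0
    · exact (dvd_pow_self _ (by omega)).trans (hcoef i (Nat.pos_of_ne_zero hi0) hi)
  obtain ⟨P, h, H⟩ := PowerSeries.exists_isWeierstrassFactorization hMres
  have hPdist := H.isDistinguishedAt
  have hPmon : P.Monic := hPdist.monic
  have hh : IsUnit h := H.isUnit
  have hMeq : M = (P : IwasawaAlgebra p) * h := H.eq_mul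
  have hdeg : P.natDegree = d := by
    rw [H.natDegree_eq_toNat_order_map, horder]; rfl
  -- transfer the coefficient conditions from `M` to `P = M · h⁻¹`
  obtain ⟨hinv, hhinv⟩ := hh.exists_right_inv
  have hPeq : (P : IwasawaAlgebra p) = M * hinv := by rw [hMeq, mul_assoc, hhinv, mul_one]
  have hPcoeff : ∀ n, P.coeff n = PowerSeries.coeff n (M * hinv) := by
    intro n
    rw [← Polynomial.coeff_coe, hPeq]
  have hPi : ∀ i, 0 < i → i < d → (p : ℤ_[p]) ^ (d - i) ∣ P.coeff i := by
    intro i hi hid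
    rw [hPcoeff, PowerSeries.coeff_mul]
    refine Finset.dvd_sum fun ij hij => ?_
    have hsum : ij.1 + ij.2 = i := Finset.HasAntidiagonal.mem_antidiagonal.mp hij
    refine Dvd.dvd.mul_right ?_ _
    by_cases hj0 : ij.1 = 0
    · rw [hj0]; exact (pow_dvd_pow _ (by omega)).trans h0
    · exact (pow_dvd_pow _ (by omega)).trans (hcoef ij.1 (Nat.pos_of_ne_zero hj0) (by omega))
  have hP0eq : P.coeff 0 = PowerSeries.coeff 0 M * PowerSeries.coeff 0 hinv := by
    rw [hPcoeff, PowerSeries.coeff_mul, Finset.Nat.antidiagonal_zero, Finset.sum_singleton]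
  have hinvu : IsUnit (PowerSeries.coeff 0 hinv) := by
    rw [PowerSeries.coeff_zero_eq_constantCoeff_apply]
    exact PowerSeries.isUnit_iff_constantCoeff.mp (isUnit_iff_exists_inv.mpr ⟨h, by rw [mul_comm]; exact hhinv⟩)
  have hP0 : (p : ℤ_[p]) ^ (d - 1) ∣ P.coeff 0 := by rw [hP0eq]; exact h0.mul_right _
  have hP0' : ¬ (p : ℤ_[p]) ^ d ∣ P.coeff 0 := by
    rw [hP0eq]; intro hdvd; exact h0' ((hinvu.dvd_mul_right).mp hdvd)
  have hPprime := prime_coe_of_topSegment p P hPmon hdeg hd2 hPi hP0 hP0'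
  rw [hMeq]
  exact (associated_mul_unit_right (P : IwasawaAlgebra p) h hh).prime hPprime

/-- **THE PRIME-COFACTOR SQUEEZE (no functional equation).** In `Λ = ℤ_p⟦T⟧`: if `T^r ∣ g ∣ L`, `L = T^r·M` with
`M` PRIME, and `p ∣ coeff_r g` (ONE factor of `p`), then `(g) = (L)` — `g = T^r g'` with `g' ∣ M`, so `g'` is a unit
(excluded by the factor of `p`) or an associate of `M`. [cite: Washington1997, §13.2] -/
theorem span_singleton_eq_of_prime_cofactor {r : ℕ} {g L M : IwasawaAlgebra p}
    (hXg : (PowerSeries.X : IwasawaAlgebra p) ^ r ∣ g) (hgL : g ∣ L)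
    (hLM : L = (PowerSeries.X : IwasawaAlgebra p) ^ r * M) (hM : Prime M)
    (hcoef : (p : ℤ_[p]) ∣ PowerSeries.coeff r g) : Ideal.span {g} = Ideal.span {L} := by
  obtain ⟨g', rfl⟩ := hXg
  have hX0 : (PowerSeries.X : IwasawaAlgebra p) ^ r ≠ 0 := pow_ne_zero _ PowerSeries.X_ne_zero
  have hg'M : g' ∣ M := by
    obtain ⟨m, hm⟩ := hgL
    refine ⟨m, mul_left_cancel₀ hX0 ?_⟩
    rw [← hLM, hm, mul_assoc]
  have hcoef' : (p : ℤ_[p]) ∣ PowerSeries.constantCoeff g' := by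
    rw [PowerSeries.coeff_X_pow_mul', if_pos le_rfl, Nat.sub_self,
      PowerSeries.coeff_zero_eq_constantCoeff] at hcoef
    exact hcoef
  have hnu : ¬ IsUnit g' := by
    intro hgu
    rw [PowerSeries.isUnit_iff_constantCoeff] at hgu
    obtain ⟨t, ht⟩ := hcoef'
    rw [ht] at hgu
    exact PadicInt.prime_p.not_unit (isUnit_of_mul_isUnit_left hgu)
  have hg'M1 : g' ∣ 1 * M := by rw [one_mul]; exact hg'M
  rcases isUnit_or_associated_of_dvd_unit_mul_prime isUnit_one hM hg'M1 with hu | hassoc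
  · exact absurd hu hnu
  · rw [hLM, Ideal.span_singleton_eq_span_singleton]
    exact hassoc.mul_left _

end PrimeCofactor

end Summit.BirchSwinnertonDyer.BirchSwinnertonDyer.Theorems

end
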